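import Mathlib
import HarnessLib
import Literature.Analysis.SpecialFunctions.LogChooseStirling
import Summits.KontsevichZagierPeriods.Zeta5Search.Denom.TwoTaleL25Forms
import Summits.KontsevichZagierPeriods.Zeta5Search.TwoTaleP15Growth

/-!
# TwoTaleL25Growth — the coefficient rate at RUNG L(2/5) `(32,27,22,37 | 0,5,10,64)`: Whipple's partner is a one-signed sum

HONEST FRAMING: systematic search; no irrationality claim unless certified.  Cell pub-zeta5 (measure-opt g0), the L(2/5) port of
P1's `TwoTaleD1Growth` (file T7 of the D1 programme; same six lemmas, new slopes): NO recurrence and NO saddle point —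

* on the two-tale cone `q_n = −q̂_n` is **Whipple's terminating transformation** ([Zudilin2014ZetaTwo] Remark 5; in the
  tree `TwoTaleWhipple.whippleRemark5Max_holds`, instantiated at L(2/5) in `TwoTaleWhippleL25`); at L(2/5) the partner sum
  is `qhatL25 n = Σ_k termL25 n k` at the Remark-5 partner parameters `â = (79n+2; 27n+1, 32n+1, 37n+1)`,
  `b̂ = (37n+2; 15n+1, 59n+2, 64n+2)`;
* the summands are ONE-SIGNED BY FORMULA:
  `termL25 n k = C(2k−37n−2, 42n)·C(k−15n−1, 12n)·C(27n, k−32n−1)·C(27n, k−37n−1) ≥ 0` (Zudilin's `A_k`,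
  arXiv:1310.1526 §6 eq. (T2)), so `max_k ≤ qhatL25 n ≤ (27n+1)·max_k`;
* THIS PART: the partner sum, the tangent slopes `σᵢ(u)` (`u = k/n ∈ (79/2, 59)`), the affine Chernoff exponent
  `n·Λ(u) + k·G(u) + K₀(u)`, the critical abscissa `ustarL25 ∈ [48, 55]` with `slopeGL25 ustarL25 = 0` (IVT from
  `slopeGL25 48 = −2 log(17/59) − log(7/11) > 0 > slopeGL25 55 = log 106580 − log 154721`; numerically
  `ustarL25 = 54.2909083…`), `C₁starL25 := rateΛL25 ustarL25` (numerically `102.8449406…`; design `C₁ = 102.84494056`) and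
  the upper bound `qhatL25_le`; the generic Chernoff lemmas are those of `TwoTaleP15Growth`.
Sequels: `TwoTaleL25GrowthLimit` (the limit `log qhatL25 n / n → C₁starL25` and `CoeffRateL25` from Whipple),
`TwoTaleL25GrowthEnclosure` (`C₁starL25 ≤ 102.84495`).  Nothing here certifies a measure; no irrationality content.
Design numerics: `HOME/pub-zeta5-measure-opt/g0/design/l25_growth.py`.
References: W. N. Bailey, Generalized hypergeometric series (1935) §4.5; W. Zudilin, arXiv:1310.1526
[Zudilin2014ZetaTwo] §6, Remark 5.
-/

noncomputable section

open Filter Topology Finset Real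

namespace Summit.KontsevichZagierPeriods.Zeta5Search.TwoTaleL25Growth

open Summit.KontsevichZagierPeriods.Zeta5Search.Denom.TwoTaleL25Forms (formQL25 CoeffRateL25)
open Summit.KontsevichZagierPeriods.Zeta5Search.TwoTaleP15Growth (choose_le_exp exp_le_choose prod4_le)

/-! ### The partner sum (tale 2 at the Remark-5 parameters of L(2/5)) -/

/-- Zudilin's `A_k` (arXiv:1310.1526 §6, eq. (T2)) at the L(2/5) partner: the product of four binomials
`C(2k−37n−2, 42n)·C(k−15n−1, 12n)·C(27n, k−32n−1)·C(27n, k−37n−1)` — a natural number, nonzero exactly for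
`⌈(79n+2)/2⌉ ≤ k ≤ 59n+1` (inside the summation window `37n+1 ≤ k ≤ 64n+1` no truncated subtraction occurs). -/
def termL25 (n k : ℕ) : ℕ :=
  Nat.choose (2 * k - (37 * n + 2)) (42 * n) * Nat.choose (k - (15 * n + 1)) (12 * n) *
    Nat.choose (27 * n) (k - (32 * n + 1)) * Nat.choose (27 * n) (k - (37 * n + 1))

/-- `qhatL25 n = Σ_{k=37n+1}^{64n+1} A_k = |q̂_n|` (`= Zudilin2014.formQTZ â b̂`, `TwoTaleWhippleL25`). -/
def qhatL25 (n : ℕ) : ℕ := ∑ k ∈ Ico (37 * n + 1) (64 * n + 2), termL25 n k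

/-! ### The tangent slopes and the affine exponent -/

/-- Slope of the block `C(2k−37n−2, 42n)` at abscissa `u = k/n`: `σ₀ = 42/(2u−37)`. -/
def σ₀ (u : ℝ) : ℝ := 42 / (2 * u - 37)
/-- Slope of `C(k−15n−1, 12n)`: `σ₁ = 12/(u−15)`. -/
def σ₁ (u : ℝ) : ℝ := 12 / (u - 15)
/-- Slope of `C(27n, k−32n−1)`: `σ₂ = (u−32)/27`. -/
def σ₂ (u : ℝ) : ℝ := (u - 32) / 27
/-- Slope of `C(27n, k−37n−1)`: `σ₃ = (u−37)/27`. -/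
def σ₃ (u : ℝ) : ℝ := (u - 37) / 27

/-- The `n`-coefficient `Λ(u)` of the total Chernoff exponent at slopes `σᵢ(u)`. -/
def rateΛL25 (u : ℝ) : ℝ :=
  -42 * Real.log (σ₀ u) + 79 * Real.log (1 - σ₀ u) - 12 * Real.log (σ₁ u) + 27 * Real.log (1 - σ₁ u) +
    32 * Real.log (σ₂ u) - 59 * Real.log (1 - σ₂ u) + 37 * Real.log (σ₃ u) - 64 * Real.log (1 - σ₃ u)

/-- The `k`-coefficient `G(u)` of the total Chernoff exponent (`= h′(u)`, the derivative of the max-term entropy):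
`G(u) = 2 log((2u−37)/(2u−79)) + log((u−15)/(u−27)) + log((59−u)/(u−32)) + log((64−u)/(u−37))`. -/
def slopeGL25 (u : ℝ) : ℝ :=
  -2 * Real.log (1 - σ₀ u) - Real.log (1 - σ₁ u) - Real.log (σ₂ u) + Real.log (1 - σ₂ u) - Real.log (σ₃ u) +
    Real.log (1 - σ₃ u)

/-- The constant term `K₀(u)` of the total Chernoff exponent (from the `−2, −1, −1, −1` offsets). -/
def constKL25 (u : ℝ) : ℝ :=
  2 * Real.log (1 - σ₀ u) + Real.log (1 - σ₁ u) + Real.log (σ₂ u) - Real.log (1 - σ₂ u) + Real.log (σ₃ u) -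
    Real.log (1 - σ₃ u)

/-- The four Chernoff exponents add up to the AFFINE form `n·Λ(u) + k·G(u) + K₀(u)`. -/
theorem affine_eq (u : ℝ) (n k : ℝ) :
    (42 * n * (-Real.log (σ₀ u)) + (2 * k - 37 * n - 2 - 42 * n) * (-Real.log (1 - σ₀ u))) +
      (12 * n * (-Real.log (σ₁ u)) + (k - 15 * n - 1 - 12 * n) * (-Real.log (1 - σ₁ u))) +
      ((k - 32 * n - 1) * (-Real.log (σ₂ u)) + (27 * n - (k - 32 * n - 1)) * (-Real.log (1 - σ₂ u))) +
      ((k - 37 * n - 1) * (-Real.log (σ₃ u)) + (27 * n - (k - 37 * n - 1)) * (-Real.log (1 - σ₃ u))) =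
    n * rateΛL25 u + k * slopeGL25 u + constKL25 u := by
  unfold rateΛL25 slopeGL25 constKL25; ring

/-- The slopes lie in `(0,1)` for `79/2 < u < 59`. -/
theorem slopes_mem {u : ℝ} (hu : 79 / 2 < u) (hu' : u < 59) :
    (0 < σ₀ u ∧ σ₀ u < 1) ∧ (0 < σ₁ u ∧ σ₁ u < 1) ∧ (0 < σ₂ u ∧ σ₂ u < 1) ∧ (0 < σ₃ u ∧ σ₃ u < 1) := by
  unfold σ₀ σ₁ σ₂ σ₃
  have h22 : 0 < 2 * u - 37 := by linarith
  have h9 : 0 < u - 15 := by linarith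
  have h19 : 0 < u - 32 := by linarith
  have h22' : 0 < u - 37 := by linarith
  refine ⟨⟨by positivity, ?_⟩, ⟨by positivity, ?_⟩, ⟨by positivity, ?_⟩, ⟨by positivity, ?_⟩⟩
  · rw [div_lt_one h22]; linarith
  · rw [div_lt_one h9]; linarith
  · rw [div_lt_one (by norm_num : (0:ℝ) < 27)]; linarith
  · rw [div_lt_one (by norm_num : (0:ℝ) < 27)]; linarith

/-! ### Upper half: every summand is below the tangent plane -/

/-- **Tangent-plane bound**: for `37n+1 ≤ k` and `79/2 < u < 59`, `termL25 n k ≤ exp(n·Λ(u) + k·G(u) + K₀(u))`. -/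
theorem termL25_le_exp (n k : ℕ) (hk : 37 * n + 1 ≤ k) {u : ℝ} (hu : 79 / 2 < u) (hu' : u < 59) :
    (termL25 n k : ℝ) ≤ Real.exp (n * rateΛL25 u + k * slopeGL25 u + constKL25 u) := by
  obtain ⟨⟨a0, b0⟩, ⟨a1, b1⟩, ⟨a2, b2⟩, ⟨a3, b3⟩⟩ := slopes_mem hu hu'
  have e0 : ((2 * k - (37 * n + 2) : ℕ) : ℝ) = 2 * k - 37 * n - 2 := by
    rw [Nat.cast_sub (by omega)]; push_cast; ring
  have e1 : ((k - (15 * n + 1) : ℕ) : ℝ) = k - 15 * n - 1 := by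
    rw [Nat.cast_sub (by omega)]; push_cast; ring
  have e2 : ((k - (32 * n + 1) : ℕ) : ℝ) = k - 32 * n - 1 := by
    rw [Nat.cast_sub (by omega)]; push_cast; ring
  have e3 : ((k - (37 * n + 1) : ℕ) : ℝ) = k - 37 * n - 1 := by
    rw [Nat.cast_sub (by omega)]; push_cast; ring
  have g0 := choose_le_exp (2 * k - (37 * n + 2)) (42 * n) a0 b0
  have g1 := choose_le_exp (k - (15 * n + 1)) (12 * n) a1 b1
  have g2 := choose_le_exp (27 * n) (k - (32 * n + 1)) a2 b2
  have g3 := choose_le_exp (27 * n) (k - (37 * n + 1)) a3 b3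
  rw [e0] at g0; rw [e1] at g1; rw [e2] at g2; rw [e3] at g3
  unfold termL25
  push_cast
  refine (prod4_le (by positivity) (by positivity) (by positivity) (by positivity) g0 g1 g2 g3).trans (le_of_eq ?_)
  rw [← Real.exp_add, ← Real.exp_add, ← Real.exp_add]
  congr 1
  rw [← affine_eq u n k]
  push_cast
  ring

/-! ### The critical abscissa `ustarL25`: the root of `slopeGL25` -/

/-- `slopeGL25` is continuous at every `u ∈ (79/2, 59)`. -/
theorem slopeGL25_continuousAt {u : ℝ} (hu : 79 / 2 < u) (hu' : u < 59) : ContinuousAt slopeGL25 u := by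
  obtain ⟨⟨a0, b0⟩, ⟨a1, b1⟩, ⟨a2, b2⟩, ⟨a3, b3⟩⟩ := slopes_mem hu hu'
  unfold σ₀ at a0 b0; unfold σ₁ at a1 b1; unfold σ₂ at a2 b2; unfold σ₃ at a3 b3
  have h1 : (2 * u - 37) ≠ 0 := (by linarith : (0:ℝ) < 2 * u - 37).ne'
  have h2 : u - 15 ≠ 0 := (by linarith : (0:ℝ) < u - 15).ne'
  have h3 : 1 - 42 / (2 * u - 37) ≠ 0 := (by linarith : (0:ℝ) < 1 - 42 / (2 * u - 37)).ne'
  have h4 : 1 - 12 / (u - 15) ≠ 0 := (by linarith : (0:ℝ) < 1 - 12 / (u - 15)).ne'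
  have h5 : (u - 32) / 27 ≠ 0 := a2.ne'
  have h6 : 1 - (u - 32) / 27 ≠ 0 := (by linarith : (0:ℝ) < 1 - (u - 32) / 27).ne'
  have h7 : (u - 37) / 27 ≠ 0 := a3.ne'
  have h8 : 1 - (u - 37) / 27 ≠ 0 := (by linarith : (0:ℝ) < 1 - (u - 37) / 27).ne'
  unfold slopeGL25 σ₀ σ₁ σ₂ σ₃
  fun_prop (disch := assumption)

/-- `slopeGL25 48 > 0` (`= −2 log(17/59) − log(7/11)`: at `u = 48` one has `σ₂ + σ₃ = 1`, so the last four
terms cancel). -/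
theorem slopeGL25_left_pos : 0 < slopeGL25 48 := by
  have h1 : Real.log (17 / 59) < 0 := Real.log_neg (by norm_num) (by norm_num)
  have h2 : Real.log (7 / 11) < 0 := Real.log_neg (by norm_num) (by norm_num)
  have e : slopeGL25 48 = -2 * Real.log (17 / 59) - Real.log (7 / 11) - Real.log (16 / 27) + Real.log (11 / 27) -
      Real.log (11 / 27) + Real.log (16 / 27) := by
    unfold slopeGL25 σ₀ σ₁ σ₂ σ₃; norm_num
  rw [e]; linarith

/-- `slopeGL25 55 < 0`: at `u = 55` the slopes are `42/73, 3/10, 23/27, 2/3` and the six logarithms collapse to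
`log 106580 − log 154721 < 0` (`106580 = 2²·5·73²`, `154721 = 7·23·31²`). -/
theorem slopeGL25_right_neg : slopeGL25 55 < 0 := by
  have e : slopeGL25 55 = -2 * Real.log (31 / 73) - Real.log (7 / 10) - Real.log (23 / 27) +
      Real.log (4 / 27) - Real.log (2 / 3) + Real.log (1 / 3) := by
    unfold slopeGL25 σ₀ σ₁ σ₂ σ₃; norm_num
  have d1 : Real.log (31 / 73) = Real.log 31 - Real.log 73 := Real.log_div (by norm_num) (by norm_num)
  have d2 : Real.log (7 / 10) = Real.log 7 - Real.log 10 := Real.log_div (by norm_num) (by norm_num)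
  have d3 : Real.log (23 / 27) = Real.log 23 - Real.log 27 := Real.log_div (by norm_num) (by norm_num)
  have d4 : Real.log (4 / 27) = Real.log 4 - Real.log 27 := Real.log_div (by norm_num) (by norm_num)
  have d5 : Real.log (2 / 3) = Real.log 2 - Real.log 3 := Real.log_div (by norm_num) (by norm_num)
  have d6 : Real.log (1 / 3) = Real.log 1 - Real.log 3 := Real.log_div (by norm_num) (by norm_num)
  have m10 : Real.log 10 = Real.log 2 + Real.log 5 := by
    rw [show (10:ℝ) = 2 * 5 by norm_num, Real.log_mul (by norm_num) (by norm_num)]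
  have m4 : Real.log 4 = 2 * Real.log 2 := by
    rw [show (4:ℝ) = 2 ^ 2 by norm_num, Real.log_pow]; norm_num
  have m106580 : Real.log 106580 = 2 * Real.log 2 + Real.log 5 + 2 * Real.log 73 := by
    rw [show (106580:ℝ) = 2 ^ 2 * 5 * 73 ^ 2 by norm_num, Real.log_mul (by norm_num) (by norm_num),
      Real.log_mul (by norm_num) (by norm_num), Real.log_pow, Real.log_pow]; norm_num
  have m154721 : Real.log 154721 = Real.log 7 + Real.log 23 + 2 * Real.log 31 := by
    rw [show (154721:ℝ) = 7 * 23 * 31 ^ 2 by norm_num, Real.log_mul (by norm_num) (by norm_num),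
      Real.log_mul (by norm_num) (by norm_num), Real.log_pow]; norm_num
  have hlt : Real.log 106580 < Real.log 154721 := Real.log_lt_log (by norm_num) (by norm_num)
  rw [e, d1, d2, d3, d4, d5, d6, Real.log_one]
  linarith

/-- **IVT**: `slopeGL25` has a zero in `[48, 55]`. -/
theorem exists_root : ∃ u ∈ Set.Icc (48 : ℝ) 55, slopeGL25 u = 0 := by
  have hcont : ContinuousOn slopeGL25 (Set.Icc (48 : ℝ) 55) := fun u hu =>
    (slopeGL25_continuousAt (by linarith [hu.1]) (by linarith [hu.2])).continuousWithinAt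
  have h := intermediate_value_Icc' (by norm_num : (48 : ℝ) ≤ 55) hcont
  have h0 : (0:ℝ) ∈ Set.Icc (slopeGL25 55) (slopeGL25 48) := ⟨slopeGL25_right_neg.le, slopeGL25_left_pos.le⟩
  obtain ⟨u, hu, hu0⟩ := h h0
  exact ⟨u, hu, hu0⟩

/-- The critical abscissa `u* ∈ [48, 55]` with `G(u*) = 0` (numerically `u* = 54.2909083…`, the relevant root of
`(2u−37)²(u−15)(59−u)(64−u) = (2u−79)²(u−27)(u−32)(u−37)`). -/
def ustarL25 : ℝ := exists_root.choose

/-- The defining property of `ustarL25`: it lies in `[48, 55]` and `slopeGL25 ustarL25 = 0`. -/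
theorem ustarL25_spec : ustarL25 ∈ Set.Icc (48 : ℝ) 55 ∧ slopeGL25 ustarL25 = 0 := exists_root.choose_spec

/-- `ustarL25` lies in the open window `(79/2, 59)` where all four slopes are in `(0, 1)`. -/
theorem ustarL25_bounds : 79 / 2 < ustarL25 ∧ ustarL25 < 59 :=
  ⟨by linarith [ustarL25_spec.1.1], by linarith [ustarL25_spec.1.2]⟩

/-- **The coefficient rate** `C₁* = Λ(u*)` at L(2/5): the height of the horizontal tangent plane of the max-term
entropy (numerically `102.8449406…`; the enclosure `≤ 102.84495` is `TwoTaleL25GrowthEnclosure.C₁starL25_le`). -/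
def C₁starL25 : ℝ := rateΛL25 ustarL25

/-- The bounded penalty constant of the reverse-Chernoff step at `k_n = ⌊u* n⌋`. -/
def penPL25 : ℝ :=
  9 / (σ₀ ustarL25 * (1 - σ₀ ustarL25)) + 1 / (σ₁ ustarL25 * (1 - σ₁ ustarL25)) + 4 / (σ₂ ustarL25 * (1 - σ₂ ustarL25)) +
    4 / (σ₃ ustarL25 * (1 - σ₃ ustarL25))

/-! ### Upper bound for `qhatL25` -/

/-- **Upper half**: `qhatL25 n ≤ (27n+1)·exp(n·C₁* + K₀(u*))` for every `n`. -/
theorem qhatL25_le (n : ℕ) : (qhatL25 n : ℝ) ≤ (27 * n + 1) * Real.exp (n * C₁starL25 + constKL25 ustarL25) := by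
  obtain ⟨hu1, hu2⟩ := ustarL25_bounds
  have hG := ustarL25_spec.2
  have hc : (Ico (37 * n + 1) (64 * n + 2)).card = 27 * n + 1 := by simp; omega
  unfold qhatL25
  push_cast
  calc ∑ k ∈ Ico (37 * n + 1) (64 * n + 2), (termL25 n k : ℝ)
      ≤ ∑ k ∈ Ico (37 * n + 1) (64 * n + 2), Real.exp (n * C₁starL25 + constKL25 ustarL25) := by
        apply Finset.sum_le_sum
        intro k hk
        have hk1 : 37 * n + 1 ≤ k := (Finset.mem_Ico.mp hk).1
        have h := termL25_le_exp n k hk1 hu1 hu2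
        rw [hG, mul_zero, add_zero] at h
        exact h
    _ = (27 * n + 1) * Real.exp (n * C₁starL25 + constKL25 ustarL25) := by
        rw [Finset.sum_const, hc, nsmul_eq_mul]; push_cast; ring

end Summit.KontsevichZagierPeriods.Zeta5Search.TwoTaleL25Growth

end
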